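import Summits.Ventures.HSemireg.Pad4TowerB1OddBoostBlind

/-!
# Cruxes ∕ BlochSeedDiscOne — `LineConfinement h`: the SPAN INDUCTION (anomaly lens g8, A22 carried object; PROOF-SKETCH-FLOORTOP-LAW §2 made a kernel theorem)

HONEST FRAMING. Crux of record stmt-HodgeConjecture-18881 `BlochSeedDiscOne` (skeleton `Lines/birth.lean` 814a6a70c14e831a UNTOUCHED). Object: the typed
candidate `LineConfinement h` of `Cruxes/BlochSeedDiscOne/ThinnessTarget.lean` v4 §6 (restated here BYTE-FOR-BYTE, as in `LineConfinementKernel.lean`, because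
`Cruxes/` workfiles do not import each other; the three `LineConfinement`s are syntactically identical terms). PROVED HERE, sorry-free, census-neutral:
the inductive SCHEMA only — `lineConfinement_of_step : LineConfinement (h - 2) → LineConfinementStep h → LineConfinement h` for EVEN `h`, by three cases
(support misses the ceiling line ⇒ it lies in `◇_{h-2}`; support misses the floor ⇒ boost it down by 2 with the tree's PROVED boost blindness
`staticH1BoostInvariant_holds`; else it is FULL-SPAN and the step hypothesis applies), its converse, the iteration from the base `h = 2` (unbounded and rung-by-rung: `lineConfinement_of_steps_le`, `lineConfinement_four ∕ _six ∕ _eight`).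
`LineConfinementStep h` (confinement for supports touching BOTH the floor line `α = c` and the ceiling line `α + c = h`) is proved for NO `h` here;
`LineConfinement h` itself is proved for NO new `h` here (the base `LineConfinement 2` is kernel-confine-1's `lineConfinement_two`, taken as a hypothesis
below because it lives in another workfile). NOTHING HERE SAYS THAT HC ∕ HC_CM ∕ HC_AV ∕ H2 ∕ 18881 ∕ (T_h) HOLDS OR FAILS. No `sorry`, no `axiom`, no
`instance`, no notation, no Literature fact. Why this schema: the A22 instrument law (kit j334158 ∕ j336215; READ-A22-CORE-LADDER, PROOF-SKETCH-FLOORTOP-LAW §1)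
says the layered-UP hard core of `◇_h` restricted to `◇_{h-2}` IS the hard core of `◇_{h-2}` and every new hard cell touches the ceiling line — i.e. the
only new content at height `h` is the full-span step.
-/

namespace Summit.Ventures.HSemireg.Pad4Tower

namespace AnomalyLens

namespace ConfinementSpan

open Finset

/-! ## §1 The statement of record (verbatim restatement) -/

/-- number of charged letters (`β ≠ 0`) of a cell. -/
abbrev chargedCount (Z : MCell) : ℕ := (univ.filter fun f : Fin 4 => (Z f).2 ≠ (0, 0)).card

/-- a cell is THIN: at most one charged letter. -/
abbrev ThinCell (Z : MCell) : Prop := chargedCount Z ≤ 1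

/-- a cell is SINGLE-LINE: all four letters have the same causal height `α + c`. -/
abbrev SingleLine (Z : MCell) : Prop := ∀ f, (Z f).1 + absCharge (Z f) = (Z 0).1 + absCharge (Z 0)

/-- **`LineConfinement h`** (verbatim `ThinnessTarget` §6 ∕ `LineConfinementKernel` §1). -/
def LineConfinement (h : ℤ) : Prop :=
  ∀ C : MConfig, C.InDiamond h → C.G1Closed → C.StaticH1 →
    (∀ Z ∈ C.lower, ¬ ThinCell Z → SingleLine Z) ∧ ∀ P ∈ C.upper, ¬ ThinCell P → SingleLine P

/-! ## §2 Full-span supports and the step statement -/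

/-- a support is CEILING-ANCHORED at height `h`: some letter of some present cell lies on the ceiling line `α + c = h`. -/
abbrev CeilingAnchored (h : ℤ) (C : MConfig) : Prop :=
  (∃ Z ∈ C.lower, ∃ f, OnCeiling h (Z f)) ∨ ∃ P ∈ C.upper, ∃ f, OnCeiling h (P f)

/-- **`LineConfinementStep h`**: confinement for FULL-SPAN supports only — touching the floor line (`FloorAnchored`) AND the ceiling line `h`. Proved for NO `h`. -/
def LineConfinementStep (h : ℤ) : Prop :=
  ∀ C : MConfig, C.InDiamond h → C.G1Closed → C.StaticH1 → C.FloorAnchored → CeilingAnchored h C →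
    (∀ Z ∈ C.lower, ¬ ThinCell Z → SingleLine Z) ∧ ∀ P ∈ C.upper, ¬ ThinCell P → SingleLine P

/-- the step is a special case of confinement. -/
theorem step_of_lineConfinement {h : ℤ} (H : LineConfinement h) : LineConfinementStep h :=
  fun C hU hG hS _ _ => H C hU hG hS

/-- confinement is antitone in `h` (a `◇_h` support is a `◇_{h'}` support for `h ≤ h'`). -/
theorem lineConfinement_antitone {h h' : ℤ} (hh : h ≤ h') (H : LineConfinement h') : LineConfinement h :=
  fun C hU hG hS => H C ⟨fun Z hZ f => inDiamond_mono hh (hU.1 Z hZ f), fun P hP f => inDiamond_mono hh (hU.2 P hP f)⟩ hG hS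

/-! ## §3 Boost blindness of the two cell predicates -/

/-- the boost keeps `β`, hence the charged count. -/
theorem chargedCount_boost (s : ℤ) (Z : MCell) : chargedCount (Z.boost s) = chargedCount Z := rfl

/-- thinness is boost-blind. -/
theorem thinCell_boost_iff (s : ℤ) (Z : MCell) : ThinCell (Z.boost s) ↔ ThinCell Z := Iff.rfl

/-- single-line-ness is boost-blind (all causal heights shift by `s`). -/
theorem singleLine_boost_iff (s : ℤ) (Z : MCell) : SingleLine (Z.boost s) ↔ SingleLine Z := by
  constructor
  · intro H f
    have e := H f
    simp only [MCell.boost, boostPt, absCharge_boostPt] at e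
    change (Z f).1 + s + absCharge (Z f) = (Z 0).1 + s + absCharge (Z 0) at e
    omega
  · intro H f
    have e := H f
    show (Z f).1 + s + absCharge (boostPt s (Z f)) = (Z 0).1 + s + absCharge (boostPt s (Z 0))
    rw [absCharge_boostPt, absCharge_boostPt]; omega

/-! ## §4 The span induction -/

/-- **THE STEP LEMMA.** For even `h`: confinement at `h - 2` and the full-span step at `h` give confinement at `h`. Three cases on a static `G₁`-closed
support `C ⊂ ◇_h`: (a) no letter on the ceiling line ⇒ every causal height is even and `< h`, so `C ⊂ ◇_{h-2}`; (b) no letter on the floor line ⇒ every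
node level is even and `> 0`, so the boost by `-2` lands in `◇_{h-2}` and stays static ∕ `G₁`-closed (`staticH1BoostInvariant_holds`), and thin ∕
single-line are boost-blind; (c) otherwise `C` is full-span. -/
theorem lineConfinement_of_step {h : ℤ} (hh : h % 2 = 0) (ih : LineConfinement (h - 2)) (step : LineConfinementStep h) :
    LineConfinement h := by
  intro C hU hG hS
  have hdia : ∀ Z, (Z ∈ C.lower ∨ Z ∈ C.upper) → ∀ f, InDiamond h (Z f) := by
    intro Z hZ f
    rcases hZ with hZ | hZ
    · exact hU.1 Z hZ f
    · exact hU.2 Z hZ f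
  by_cases hc : CeilingAnchored h C
  · by_cases hf : C.FloorAnchored
    · exact step C hU hG hS hf hc
    · -- case (b): boost down by 2
      have hlev : ∀ Z, (Z ∈ C.lower ∨ Z ∈ C.upper) → ∀ f, absCharge (Z f) + 2 ≤ (Z f).1 := by
        intro Z hZ f
        have hx := hdia Z hZ f
        have hnf : ¬ OnFloor (Z f) := by
          intro hfl
          rcases hZ with hZ | hZ
          · exact hf (Or.inl ⟨Z, hZ, f, hfl⟩)
          · exact hf (Or.inr ⟨Z, hZ, f, hfl⟩)
        have h1 := hx.2.1
        have h2 := hx.2.2.1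
        have h3 : (Z f).1 ≠ absCharge (Z f) := hnf
        omega
      have hU' : (C.boostImage (-2)).InDiamond (h - 2) := by
        constructor
        · intro W hW f
          obtain ⟨Z, hZ, rfl⟩ := Finset.mem_image.mp hW
          have hx := hdia Z (Or.inl hZ) f
          have hle := hlev Z (Or.inl hZ) f
          show InDiamond (h - 2) (boostPt (-2) (Z f))
          exact inDiamond_boostPt hx (by decide) (by omega) (by have := hx.2.2.2; omega)
        · intro W hW f
          obtain ⟨Z, hZ, rfl⟩ := Finset.mem_image.mp hW
          have hx := hdia Z (Or.inr hZ) f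
          have hle := hlev Z (Or.inr hZ) f
          show InDiamond (h - 2) (boostPt (-2) (Z f))
          exact inDiamond_boostPt hx (by decide) (by omega) (by have := hx.2.2.2; omega)
      obtain ⟨hSi, hGi, -⟩ :=
        staticH1BoostInvariant_holds (-2) C (inCone_of_inDiamond' hU) (inCone_of_inDiamond' hU')
      have H := ih _ hU' (hGi.mp hG) (hSi.mp hS)
      constructor
      · intro Z hZ hth
        have h1 := H.1 (Z.boost (-2)) (Finset.mem_image_of_mem _ hZ) ((thinCell_boost_iff (-2) Z).not.mpr hth)
        exact (singleLine_boost_iff (-2) Z).mp h1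
      · intro P hP hth
        have h1 := H.2 (P.boost (-2)) (Finset.mem_image_of_mem _ hP) ((thinCell_boost_iff (-2) P).not.mpr hth)
        exact (singleLine_boost_iff (-2) P).mp h1
  · -- case (a): the support lies in ◇_{h-2}
    have hU2 : C.InDiamond (h - 2) := by
      have key : ∀ Z, (Z ∈ C.lower ∨ Z ∈ C.upper) → ∀ f, InDiamond (h - 2) (Z f) := by
        intro Z hZ f
        have hx := hdia Z hZ f
        have hnc : ¬ OnCeiling h (Z f) := by
          intro hcl
          rcases hZ with hZ | hZ
          · exact hc (Or.inl ⟨Z, hZ, f, hcl⟩)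
          · exact hc (Or.inr ⟨Z, hZ, f, hcl⟩)
        have h3 : (Z f).1 + absCharge (Z f) ≠ h := hnc
        refine ⟨hx.1, hx.2.1, hx.2.2.1, ?_⟩
        have h2 := hx.2.2.1
        have h4 := hx.2.2.2
        omega
      exact ⟨fun Z hZ f => key Z (Or.inl hZ) f, fun P hP f => key P (Or.inr hP) f⟩
    exact ih C hU2 hG hS

/-- for even `h`, confinement at `h` is EXACTLY confinement at `h - 2` plus the full-span step at `h`. -/
theorem lineConfinement_iff_step {h : ℤ} (hh : h % 2 = 0) :
    LineConfinement h ↔ LineConfinement (h - 2) ∧ LineConfinementStep h :=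
  ⟨fun H => ⟨lineConfinement_antitone (by omega) H, step_of_lineConfinement H⟩,
    fun H => lineConfinement_of_step hh H.1 H.2⟩

/-- **THE SPAN INDUCTION**: from the base `LineConfinement 2` (kernel-confine-1's `lineConfinement_two`, in `LineConfinementKernel.lean`; a hypothesis here
because workfiles do not import each other) and the full-span steps at the even heights `4, 6, …, 2n`, confinement at `2n`. -/
theorem lineConfinement_of_steps (base : LineConfinement 2)
    (steps : ∀ k : ℕ, 2 ≤ k → LineConfinementStep (2 * (k : ℤ))) : ∀ n : ℕ, 1 ≤ n → LineConfinement (2 * (n : ℤ)) := by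
  intro n
  induction n with
  | zero => intro h; omega
  | succ m ihm =>
    intro _
    rcases Nat.eq_zero_or_pos m with hm | hm
    · subst hm
      simpa using base
    · have ih2 : LineConfinement (2 * ((m + 1 : ℕ) : ℤ) - 2) := by
        have e : 2 * ((m + 1 : ℕ) : ℤ) - 2 = 2 * (m : ℤ) := by push_cast; ring
        rw [e]; exact ihm hm
      exact lineConfinement_of_step (by omega) ih2 (steps (m + 1) (by omega))

/-- the RUNG-BY-RUNG form: the base and the full-span steps at `4, 6, …, 2n` ONLY give confinement at `2n`. -/
theorem lineConfinement_of_steps_le (base : LineConfinement 2) (n : ℕ)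
    (steps : ∀ k : ℕ, 2 ≤ k → k ≤ n → LineConfinementStep (2 * (k : ℤ))) : 1 ≤ n → LineConfinement (2 * (n : ℤ)) := by
  induction n with
  | zero => intro h; omega
  | succ m ihm =>
    intro _
    rcases Nat.eq_zero_or_pos m with hm | hm
    · subst hm
      simpa using base
    · have ih2 : LineConfinement (2 * ((m + 1 : ℕ) : ℤ) - 2) := by
        have e : 2 * ((m + 1 : ℕ) : ℤ) - 2 = 2 * (m : ℤ) := by push_cast; ring
        rw [e]; exact ihm (fun k hk hkm => steps k hk (by omega)) hm
      exact lineConfinement_of_step (by omega) ih2 (steps (m + 1) (by omega) le_rfl)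

/-- rung 4: `LineConfinement 4` is the base plus the full-span step of `◇₄` (instrument: UP-only, hard core ∅; READ-F2: a 1 516-clause whole-law core). -/
theorem lineConfinement_four (base : LineConfinement 2) (s4 : LineConfinementStep 4) : LineConfinement 4 :=
  lineConfinement_of_step (h := 4) (by decide) (by simpa using base) s4

/-- rung 6: add the full-span step of `◇₆` (instrument: 7 UP rounds + the ten ceiling-apex cells R5 ∪ R6). -/
theorem lineConfinement_six (base : LineConfinement 2) (s4 : LineConfinementStep 4) (s6 : LineConfinementStep 6) :
    LineConfinement 6 :=
  lineConfinement_of_step (h := 6) (by decide) (by simpa using lineConfinement_four base s4) s6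

/-- rung 8 (the height of record, `◇₈`): add the full-span step of `◇₈` (instrument: 17 UP rounds + the 78 cells of R1–R7 carrying `8I`). -/
theorem lineConfinement_eight (base : LineConfinement 2) (s4 : LineConfinementStep 4) (s6 : LineConfinementStep 6)
    (s8 : LineConfinementStep 8) : LineConfinement 8 :=
  lineConfinement_of_step (h := 8) (by decide) (by simpa using lineConfinement_six base s4 s6) s8

/-- odd heights add nothing: a `◇_{2n+1}` letter has even causal height, so `LineConfinement (2n+1) ↔ LineConfinement (2n)`. -/
theorem lineConfinement_odd_iff (n : ℤ) : LineConfinement (2 * n + 1) ↔ LineConfinement (2 * n) := by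
  refine ⟨lineConfinement_antitone (by omega), fun H C hU hG hS => H C ?_ hG hS⟩
  have key : ∀ Z, (Z ∈ C.lower ∨ Z ∈ C.upper) → ∀ f, InDiamond (2 * n) (Z f) := by
    intro Z hZ f
    have hx : InDiamond (2 * n + 1) (Z f) := by
      rcases hZ with hZ | hZ
      · exact hU.1 Z hZ f
      · exact hU.2 Z hZ f
    refine ⟨hx.1, hx.2.1, hx.2.2.1, ?_⟩
    have h2 := hx.2.2.1
    have h4 := hx.2.2.2
    omega
  exact ⟨fun Z hZ f => key Z (Or.inl hZ) f, fun P hP f => key P (Or.inr hP) f⟩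

/-- so the whole tower is the base plus the even full-span steps: `(∀ k ≥ 2, LineConfinementStep (2k)) → LineConfinement 2 → ∀ h, LineConfinement h`. -/
theorem lineConfinement_all_of_steps (base : LineConfinement 2)
    (steps : ∀ k : ℕ, 2 ≤ k → LineConfinementStep (2 * (k : ℤ))) (h : ℤ) : LineConfinement h := by
  -- reduce to a large even height 2n ≥ h with n ≥ 1
  obtain ⟨n, hn1, hn⟩ : ∃ n : ℕ, 1 ≤ n ∧ h ≤ 2 * (n : ℤ) := by
    refine ⟨(Int.toNat h) + 1, by omega, ?_⟩
    have := Int.self_le_toNat h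
    push_cast; omega
  exact lineConfinement_antitone hn (lineConfinement_of_steps base steps n hn1)

end ConfinementSpan

end AnomalyLens

end Summit.Ventures.HSemireg.Pad4Tower
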